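import Summits.AtomisticToContinuum.FouriersLaw.Theses.EmbeddedDrudeMourre
import Literature.MathematicalPhysics.KineticTheory.ZeroWavenumberSpace
import Literature.MathematicalPhysics.KineticTheory.InfiniteChainSuperstableDynamics
import Literature.Analysis.UnboundedOperators.HilbertComplexification
import Literature.Analysis.UnboundedOperators.ConjugateOperatorRegularity
import Summits.AtomisticToContinuum.FouriersLaw.Theorems.EmbeddedDrudeMourreMourreDissolutionCosineBochner
import Summits.AtomisticToContinuum.FouriersLaw.Theorems.EmbeddedDrudeMourreMourreDissolutionPoissonWindowInversion
import Summits.AtomisticToContinuum.FouriersLaw.Theorems.EmbeddedDrudeMourreMourreDissolutionReflectionOddReduction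
import Summits.AtomisticToContinuum.FouriersLaw.Theorems.EmbeddedDrudeMourreMourreDissolutionFrameworkReduction
import Summits.AtomisticToContinuum.FouriersLaw.Theorems.EmbeddedDrudeMourreMourreDissolutionGibbsClustering
import Summits.AtomisticToContinuum.FouriersLaw.Theorems.EmbeddedDrudeMourreMourreDissolutionLAP

/-!
# Crux `MourreDissolution` reduced to its two physics statements (line separable-vertex-faddeev-pair-sector)

Item `stmt-AtomisticToContinuum-12594` (crux `MourreDissolution` of route `EmbeddedDrudeMourre`, sub-problem
`FouriersLaw`). This file is the SORRY-FREE part of the line's skeleton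
(`Cruxes/MourreDissolution/Lines/separable_vertex_faddeev_pair_sector.lean`): the composition
`mourreDissolution_of_stubs` (seven statements ⇒ the crux, verbatim the skeleton's) with the PROVED stubs plugged in by name —
S1 (`stub_symmetricFramework`, from S1′ `stub_gibbsClustering`, landed), S2 (`stub_cosineBochner`), S3
(`stub_poissonWindowInversion`), S4 (`stub_reflectionOddReduction`) — and S6 (`stub_mourreThresholdLAP`, Mourre's `C²` limiting absorption principle, landed) — leaving as explicit hypotheses
exactly the TWO statements not in the tree, both open physics: S5 the reflection-odd Mourre estimate at frequency 0 and S7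
the Fermi-golden-rule positivity of the plateau: `mourreDissolution_of_oddMourre_of_fgr`. It records on the ledger, as a
kernel-checked theorem, the sentence "the crux `MourreDissolution` follows from S5 ∧ S7" — the line's deliverable.
-/

noncomputable section

namespace Summit.AtomisticToContinuum.FouriersLaw.Theorems.MourreDissolution.LineReduction

open Filter Topology MeasureTheory Set ProbabilityTheory
open scoped InnerProductSpace ComplexConjugate
open Literature.MathematicalPhysics.KineticTheory.HeatConduction
open Literature.Analysis.UnboundedOperators

/-! ## Analysis used by the composition (proved) -/

section Helpers

variable {K : Type*} [NormedAddCommGroup K] [InnerProductSpace ℂ K] [CompleteSpace K]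

/-- The Laplace–Fourier integrand of a matrix coefficient is integrable on `(0, ∞)` for `ν > 0`. -/
theorem integrableOn_laplace_coeff (U : OneParameterUnitaryGroup K) (ψ : K) {ν : ℝ} (hν : 0 < ν)
    (ω : ℝ) :
    IntegrableOn (fun t : ℝ => ((Real.exp (-(ν * t)) : ℝ) : ℂ) *
        Complex.exp (-(Complex.I * ((ω * t : ℝ) : ℂ))) * ⟪ψ, U.appReal t ψ⟫_ℂ) (Set.Ioi (0:ℝ)) := by
  have hcont : Continuous fun t : ℝ => ((Real.exp (-(ν * t)) : ℝ) : ℂ) *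
      Complex.exp (-(Complex.I * ((ω * t : ℝ) : ℂ))) * ⟪ψ, U.appReal t ψ⟫_ℂ := by
    refine ((Complex.continuous_ofReal.comp (Real.continuous_exp.comp ?_)).mul ?_).mul ?_
    · exact (continuous_const.mul continuous_id).neg
    · exact Complex.continuous_exp.comp
        ((continuous_const.mul (Complex.continuous_ofReal.comp (continuous_const.mul continuous_id))).neg)
    · exact continuous_const.inner (U.continuous_appReal_apply ψ)
  have hbound : ∀ t : ℝ, ‖((Real.exp (-(ν * t)) : ℝ) : ℂ) *
      Complex.exp (-(Complex.I * ((ω * t : ℝ) : ℂ))) * ⟪ψ, U.appReal t ψ⟫_ℂ‖ ≤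
        ‖ψ‖ ^ 2 * Real.exp (-ν * t) := by
    intro t
    rw [norm_mul, norm_mul, Complex.norm_real, Real.norm_eq_abs, abs_of_pos (Real.exp_pos _)]
    have h1 : ‖Complex.exp (-(Complex.I * ((ω * t : ℝ) : ℂ)))‖ = 1 := by
      rw [Complex.norm_exp]
      simp
    rw [h1, mul_one, neg_mul]
    have h2 : ‖⟪ψ, U.appReal t ψ⟫_ℂ‖ ≤ ‖ψ‖ ^ 2 := by
      calc ‖⟪ψ, U.appReal t ψ⟫_ℂ‖ ≤ ‖ψ‖ * ‖U.appReal t ψ‖ := norm_inner_le_norm _ _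
        _ = ‖ψ‖ ^ 2 := by rw [UnitaryRep.norm_appReal, sq]
    calc Real.exp (-(ν * t)) * ‖⟪ψ, U.appReal t ψ⟫_ℂ‖ ≤ Real.exp (-(ν * t)) * ‖ψ‖ ^ 2 :=
          mul_le_mul_of_nonneg_left h2 (Real.exp_pos _).le
      _ = ‖ψ‖ ^ 2 * Real.exp (-(ν * t)) := mul_comm _ _
  refine Integrable.mono' (((exp_neg_integrableOn_Ioi 0 hν).const_mul (‖ψ‖ ^ 2))) hcont.aestronglyMeasurable ?_
  exact ae_of_all _ hbound

/-- Real part of the Laplace–Fourier transform of a REAL matrix coefficient `⟪ψ, U_t ψ⟫ = C(t)`: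
`Re ∫₀^∞ e^{-νt} e^{-iωt} C(t) dt = ∫₀^∞ e^{-νt} cos(ωt) C(t) dt`. -/
theorem re_laplace_coeff_eq (U : OneParameterUnitaryGroup K) (ψ : K) (C : ℝ → ℝ)
    (hC : ∀ t : ℝ, ⟪ψ, U.appReal t ψ⟫_ℂ = ((C t : ℝ) : ℂ)) {ν : ℝ} (hν : 0 < ν) (ω : ℝ) :
    (MeasureTheory.integral (MeasureTheory.volume.restrict (Set.Ioi (0:ℝ)))
        (fun t : ℝ => ((Real.exp (-(ν * t)) : ℝ) : ℂ) *
          Complex.exp (-(Complex.I * ((ω * t : ℝ) : ℂ))) * ⟪ψ, U.appReal t ψ⟫_ℂ)).re =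
      MeasureTheory.integral (MeasureTheory.volume.restrict (Set.Ioi (0:ℝ)))
        (fun t : ℝ => Real.exp (-(ν * t)) * Real.cos (ω * t) * C t) := by
  have hint := integrableOn_laplace_coeff U ψ hν ω
  rw [← RCLike.re_to_complex, ← integral_re hint]
  refine integral_congr_ae (ae_of_all _ fun t => ?_)
  simp only [RCLike.re_to_complex, hC t]
  have hexp : Complex.exp (-(Complex.I * ((ω * t : ℝ) : ℂ))) =
      ((Real.cos (ω * t) : ℝ) : ℂ) - Complex.I * ((Real.sin (ω * t) : ℝ) : ℂ) := by
    rw [show -(Complex.I * ((ω * t : ℝ) : ℂ)) = ((-(ω * t) : ℝ) : ℂ) * Complex.I by push_cast; ring,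
      Complex.exp_mul_I, ← Complex.ofReal_cos, ← Complex.ofReal_sin, Real.cos_neg, Real.sin_neg]
    push_cast
    ring
  rw [hexp]
  simp only [Complex.mul_re, Complex.sub_re, Complex.sub_im, Complex.ofReal_re, Complex.ofReal_im,
    Complex.mul_im, Complex.I_re, Complex.I_im]
  ring

/-- Uniform convergence passes to real parts. -/
theorem tendstoUniformlyOn_re {ι α : Type*} {F : ι → α → ℂ} {f : α → ℂ} {p : Filter ι} {s : Set α}
    (h : TendstoUniformlyOn F f p s) :
    TendstoUniformlyOn (fun i x => (F i x).re) (fun x => (f x).re) p s := by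
  have hu : UniformContinuous Complex.reCLM := Complex.reCLM.uniformContinuous
  have := hu.comp_tendstoUniformlyOn h
  simpa [Function.comp_def] using this

end Helpers

/-- The matrix coefficient of the complexified restricted Koopman group at the current class is the
summed current autocorrelation `C_T(t)`. -/
theorem coeff_unitaryGroupOfReal_currentClass {ω₂ lam β γ : ℝ}
    {D : InfiniteChainDynamics (pinnedChain ω₂ lam β γ)} (Z : ZeroWavenumberData (pinnedChain ω₂ lam β γ) D)
    (hRev : Z.HasMomentumReversal) (𝒦 : Submodule ℝ (ZeroWavenumberSpace Z)) [CompleteSpace ↥𝒦]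
    (hJ : Z.currentClass ∈ 𝒦) (V : ℝ → ↥𝒦 →L[ℝ] ↥𝒦) (h0 : V 0 = ContinuousLinearMap.id ℝ ↥𝒦)
    (hadd : ∀ s t : ℝ, V (s + t) = (V s).comp (V t)) (hnorm : ∀ (t : ℝ) (ψ : ↥𝒦), ‖V t ψ‖ = ‖ψ‖)
    (hcont : ∀ ψ : ↥𝒦, Continuous fun t : ℝ => V t ψ)
    (hagree : ∀ (t : ℝ) (ψ : ↥𝒦), ((V t ψ : ↥𝒦) : ZeroWavenumberSpace Z) =
      Z.koopman t (ψ : ZeroWavenumberSpace Z)) (t : ℝ) :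
    ⟪Complexification.ofReal (⟨Z.currentClass, hJ⟩ : ↥𝒦),
        (Complexification.unitaryGroupOfReal V h0 hadd hnorm hcont).appReal t
          (Complexification.ofReal (⟨Z.currentClass, hJ⟩ : ↥𝒦))⟫_ℂ =
      ((D.currentCorrelation Z.μ t : ℝ) : ℂ) := by
  rw [Complexification.unitaryGroupOfReal_appReal_ofReal]
  apply Complex.ext
  · rw [Complexification.inner_re, Complex.ofReal_re]
    simp only [Complexification.ofReal_re, Complexification.ofReal_im, inner_zero_right, add_zero]
    rw [Submodule.coe_inner, hagree, Submodule.coe_mk,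
      Z.inner_currentClass_koopman_eq_currentCorrelation' hRev t]
  · rw [Complexification.inner_im, Complex.ofReal_im]
    simp only [Complexification.ofReal_re, Complexification.ofReal_im, inner_zero_right,
      inner_zero_left, sub_zero]


/-- **Anchor lemma of this file (registered helper stub; the reduction theorem's own signature exceeds the ledger's
4000-character limit).** The matrix coefficient of the complexified restricted Koopman group at the current class is the
summed current autocorrelation `C_T(t)` — the identity through which the abstract limiting absorption principle (S6)
meets the chain. [folklore] -/
theorem currentCorrelation_matrixCoefficient :
    ∀ (ω₂ lam β γ : ℝ)
      (D : Literature.MathematicalPhysics.KineticTheory.HeatConduction.InfiniteChainDynamics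
        (Literature.MathematicalPhysics.KineticTheory.HeatConduction.pinnedChain ω₂ lam β γ))
      (Z : Literature.MathematicalPhysics.KineticTheory.HeatConduction.ZeroWavenumberData
        (Literature.MathematicalPhysics.KineticTheory.HeatConduction.pinnedChain ω₂ lam β γ) D),
      Z.HasMomentumReversal →
      ∀ (𝒦 : Submodule ℝ (Literature.MathematicalPhysics.KineticTheory.HeatConduction.ZeroWavenumberSpace Z))
        [CompleteSpace ↥𝒦] (hJ : Z.currentClass ∈ 𝒦) (V : ℝ → ↥𝒦 →L[ℝ] ↥𝒦)
        (h0 : V 0 = ContinuousLinearMap.id ℝ ↥𝒦) (hadd : ∀ s t : ℝ, V (s + t) = (V s).comp (V t))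
        (hnorm : ∀ (t : ℝ) (ψ : ↥𝒦), ‖V t ψ‖ = ‖ψ‖) (hcont : ∀ ψ : ↥𝒦, Continuous fun t : ℝ => V t ψ),
        (∀ (t : ℝ) (ψ : ↥𝒦),
          ((V t ψ : ↥𝒦) : Literature.MathematicalPhysics.KineticTheory.HeatConduction.ZeroWavenumberSpace Z) =
            Z.koopman t (ψ : Literature.MathematicalPhysics.KineticTheory.HeatConduction.ZeroWavenumberSpace Z)) →
        ∀ t : ℝ,
          ⟪Literature.Analysis.UnboundedOperators.Complexification.ofReal (⟨Z.currentClass, hJ⟩ : ↥𝒦),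
            (Literature.Analysis.UnboundedOperators.Complexification.unitaryGroupOfReal V h0 hadd hnorm hcont).appReal t
              (Literature.Analysis.UnboundedOperators.Complexification.ofReal (⟨Z.currentClass, hJ⟩ : ↥𝒦))⟫_ℂ =
            ((D.currentCorrelation Z.μ t : ℝ) : ℂ) :=
  fun _ _ _ _ _ Z hRev 𝒦 _ hJ V h0 hadd hnorm hcont hagree t =>
    coeff_unitaryGroupOfReal_currentClass Z hRev 𝒦 hJ V h0 hadd hnorm hcont hagree t

/-! ## The reduction -/

/-- **The crux from its two unproved physics statements.** `MourreDissolution` follows from S5 (reflection-odd strict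
Mourre estimate at frequency 0 with Mourre's `C²` regularity, under `HasOddSectorGap`, `T < T₀`) and S7 (positivity of the
Abel plateau), everything else being proved in the tree (S1–S4, S6 = `stub_mourreThresholdLAP`; the proof is the skeleton's composition `mourreDissolution_of_stubs` verbatim). [folklore] -/
theorem mourreDissolution_of_oddMourre_of_fgr
    (hS5 : ∀ ω₂ lam β γ : ℝ, 0 < ω₂ → 0 < lam → 0 < β → 0 < γ →
        Literature.MathematicalPhysics.KineticTheory.PhononBoltzmann.HasOddSectorGap ω₂ lam β →
        ∃ T₀ : ℝ, 0 < T₀ ∧ ∀ T : ℝ, 0 < T → T < T₀ →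
          ∀ (D : Literature.MathematicalPhysics.KineticTheory.HeatConduction.InfiniteChainDynamics
              (Literature.MathematicalPhysics.KineticTheory.HeatConduction.pinnedChain ω₂ lam β γ))
            (Z : Literature.MathematicalPhysics.KineticTheory.HeatConduction.ZeroWavenumberData
              (Literature.MathematicalPhysics.KineticTheory.HeatConduction.pinnedChain ω₂ lam β γ) D),
            D.carrier =
                (Literature.MathematicalPhysics.KineticTheory.HeatConduction.pinnedChain
                  ω₂ lam β γ).bmGood →
            (Literature.MathematicalPhysics.KineticTheory.HeatConduction.pinnedChain
                ω₂ lam β γ).IsChainGibbsMeasure T Z.μ →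
            (Literature.MathematicalPhysics.KineticTheory.HeatConduction.pinnedChain
                ω₂ lam β γ).HasSuperstabilityEstimate Z.μ →
            Z.HasMomentumReversal →
            MeasureTheory.MeasurePreserving (fun (σ : ℤ → ℝ × ℝ) (x : ℤ) => σ (-x)) Z.μ Z.μ →
            (∀ a : (ℤ → ℝ × ℝ) → ℝ, a ∈ Z.localObs →
              (a ∘ fun (σ : ℤ → ℝ × ℝ) (x : ℤ) => σ (-x)) ∈ Z.localObs) →
            (∀ t : ℝ, (fun (σ : ℤ → ℝ × ℝ) (x : ℤ) => σ (-x)) ∘ D.flow t =ᵐ[Z.μ]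
              D.flow t ∘ fun (σ : ℤ → ℝ × ℝ) (x : ℤ) => σ (-x)) →
            (∀ ψ : Literature.MathematicalPhysics.KineticTheory.HeatConduction.ZeroWavenumberSpace Z,
              Continuous fun t : ℝ => Z.koopman t ψ) →
            ∀ (𝒦 : Submodule ℝ
                (Literature.MathematicalPhysics.KineticTheory.HeatConduction.ZeroWavenumberSpace Z))
              [CompleteSpace ↥𝒦],
              𝒦 = (Submodule.span ℝ
                    {ψ : Literature.MathematicalPhysics.KineticTheory.HeatConduction.ZeroWavenumberSpace Z |
                      ∃ a : (ℤ → ℝ × ℝ) → ℝ, a ∈ Z.localObs ∧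
                        ψ = Z.fluct a - Z.fluct (a ∘ fun (σ : ℤ → ℝ × ℝ) (x : ℤ) => σ (-x))}).topologicalClosure →
              ∀ (hJ : Z.currentClass ∈ 𝒦) (V : ℝ → ↥𝒦 →L[ℝ] ↥𝒦)
                (h0 : V 0 = ContinuousLinearMap.id ℝ ↥𝒦)
                (hadd : ∀ s t : ℝ, V (s + t) = (V s).comp (V t))
                (hnorm : ∀ (t : ℝ) (ψ : ↥𝒦), ‖V t ψ‖ = ‖ψ‖)
                (hcont : ∀ ψ : ↥𝒦, Continuous fun t : ℝ => V t ψ),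
                (∀ (t : ℝ) (ψ : ↥𝒦),
                  ((V t ψ : ↥𝒦) :
                      Literature.MathematicalPhysics.KineticTheory.HeatConduction.ZeroWavenumberSpace Z) =
                    Z.koopman t
                      (ψ : Literature.MathematicalPhysics.KineticTheory.HeatConduction.ZeroWavenumberSpace Z)) →
                ∃ (A : Literature.Analysis.UnboundedOperators.OneParameterUnitaryGroup
                      (Literature.Analysis.UnboundedOperators.Complexification ↥𝒦)) (δ a : ℝ),
                  0 < δ ∧ 0 < a ∧
                  (Literature.Analysis.UnboundedOperators.Complexification.unitaryGroupOfReal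
                      V h0 hadd hnorm hcont).HamiltonianOfClassC1 A ∧
                  (Literature.Analysis.UnboundedOperators.Complexification.unitaryGroupOfReal
                      V h0 hadd hnorm hcont).HasMourreEstimateOn A (Set.Ioo (-δ) δ) a ∧
                  (∀ g : SchwartzMap ℝ ℂ,
                    Literature.Analysis.UnboundedOperators.UnitaryRep.IsRealCutoffOn (Set.Ioo (-δ) δ) g →
                      A.IsOfClassC1
                        ((Literature.Analysis.UnboundedOperators.Complexification.unitaryGroupOfReal
                          V h0 hadd hnorm hcont).mourreCommutator A g)) ∧
                  Literature.Analysis.UnboundedOperators.Complexification.ofReal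
                      (⟨Z.currentClass, hJ⟩ : ↥𝒦) ∈ A.hamiltonian.domain)
    (hS7 : ∀ ω₂ lam β γ : ℝ, 0 < ω₂ → 0 < lam → 0 < β → 0 < γ →
        Literature.MathematicalPhysics.KineticTheory.PhononBoltzmann.HasOddSectorGap ω₂ lam β →
        ∃ T₀ : ℝ, 0 < T₀ ∧ ∀ T : ℝ, 0 < T → T < T₀ →
          ∀ (D : Literature.MathematicalPhysics.KineticTheory.HeatConduction.InfiniteChainDynamics
              (Literature.MathematicalPhysics.KineticTheory.HeatConduction.pinnedChain ω₂ lam β γ))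
            (Z : Literature.MathematicalPhysics.KineticTheory.HeatConduction.ZeroWavenumberData
              (Literature.MathematicalPhysics.KineticTheory.HeatConduction.pinnedChain ω₂ lam β γ) D),
            D.carrier =
                (Literature.MathematicalPhysics.KineticTheory.HeatConduction.pinnedChain
                  ω₂ lam β γ).bmGood →
            (Literature.MathematicalPhysics.KineticTheory.HeatConduction.pinnedChain
                ω₂ lam β γ).IsChainGibbsMeasure T Z.μ →
            (Literature.MathematicalPhysics.KineticTheory.HeatConduction.pinnedChain
                ω₂ lam β γ).HasSuperstabilityEstimate Z.μ →
            Z.HasMomentumReversal →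
            (∀ ψ : Literature.MathematicalPhysics.KineticTheory.HeatConduction.ZeroWavenumberSpace Z,
              Continuous fun t : ℝ => Z.koopman t ψ) →
            ∃ c ν₀ : ℝ, 0 < c ∧ 0 < ν₀ ∧ ∀ ν : ℝ, 0 < ν → ν < ν₀ →
              c ≤ MeasureTheory.integral (MeasureTheory.volume.restrict (Set.Ioi (0:ℝ)))
                (fun t : ℝ => Real.exp (-(ν * t)) * D.currentCorrelation Z.μ t)) :
    Summit.AtomisticToContinuum.FouriersLaw.Theses.EmbeddedDrudeMourre.MourreDissolution := by
  intro ω₂ lam β γ hω hl hβ hγ hGap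
  obtain ⟨D, hDcar, hfam⟩ :=
    Summit.AtomisticToContinuum.FouriersLaw.Theorems.MourreDissolution.symmetricFramework_of_clustering
      Summit.AtomisticToContinuum.FouriersLaw.Theorems.MourreDissolution.stub_gibbsClustering ω₂ lam β γ hω hl hβ hγ
  obtain ⟨T₅, hT₅, hM⟩ := hS5 ω₂ lam β γ hω hl hβ hγ hGap
  obtain ⟨T₇, hT₇, hP⟩ := hS7 ω₂ lam β γ hω hl hβ hγ hGap
  refine ⟨min T₅ T₇, lt_min hT₅ hT₇, fun T hT hTlt => ?_⟩
  obtain ⟨Z, hGibbs, hSS, hRev, hιμ, hιobs, hιflow, hsc⟩ := hfam T hT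
  -- the reflection-odd sector and the restricted Koopman group (Stub 4)
  obtain ⟨𝒦, h𝒦⟩ : ∃ 𝒦 : Submodule ℝ (ZeroWavenumberSpace Z), 𝒦 = (Submodule.span ℝ
      {ψ : ZeroWavenumberSpace Z | ∃ a : (ℤ → ℝ × ℝ) → ℝ, a ∈ Z.localObs ∧
        ψ = Z.fluct a - Z.fluct (a ∘ fun (σ : ℤ → ℝ × ℝ) (x : ℤ) => σ (-x))}).topologicalClosure :=
    ⟨_, rfl⟩
  haveI h𝒦c : CompleteSpace ↥𝒦 := by rw [h𝒦]; infer_instance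
  obtain ⟨hJ, V, h0, hadd, hnorm, hcont, hagree⟩ := 
    Summit.AtomisticToContinuum.FouriersLaw.Theorems.MourreDissolution.stub_reflectionOddReduction ω₂ lam β γ D Z hιobs hιflow hsc 𝒦 h𝒦
  -- the odd-sector Mourre estimate (Stub 5)
  obtain ⟨A, δ, a, hδ, ha, hC1, hMourre, hC2, hdom⟩ :=
    hM T hT (lt_of_lt_of_le hTlt (min_le_left _ _)) D Z hDcar hGibbs hSS hRev hιμ hιobs hιflow hsc 𝒦
      h𝒦 hJ V h0 hadd hnorm hcont hagree
  -- limiting absorption (Stub 6) on the half window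
  obtain ⟨G, hGcont, hGunif⟩ := Summit.AtomisticToContinuum.FouriersLaw.Theorems.MourreDissolution.stub_mourreThresholdLAP
    (Complexification ↥𝒦)
    (Complexification.unitaryGroupOfReal V h0 hadd hnorm hcont) A (-δ) δ a (by linarith) ha hC1
    hMourre hC2 (Complexification.ofReal (⟨Z.currentClass, hJ⟩ : ↥𝒦)) hdom (-(δ / 2)) (δ / 2)
    (by linarith) (by linarith) (by linarith)
  -- the matrix coefficient is `C_T`
  have hcoef := fun t : ℝ =>
    coeff_unitaryGroupOfReal_currentClass Z hRev 𝒦 hJ V h0 hadd hnorm hcont hagree t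
  -- real parts: the Abel–Poisson transform of `C_T` converges uniformly on `[-δ/2, δ/2]`
  have hhcont : ContinuousOn (fun ω : ℝ => (G ω).re) (Set.Icc (-(δ / 2)) (δ / 2)) :=
    Complex.continuous_re.comp_continuousOn hGcont
  have hunif : TendstoUniformlyOn
      (fun (ν : ℝ) (ω : ℝ) => MeasureTheory.integral (MeasureTheory.volume.restrict (Set.Ioi (0:ℝ)))
        (fun t : ℝ => Real.exp (-(ν * t)) * Real.cos (ω * t) * D.currentCorrelation Z.μ t))
      (fun ω : ℝ => (G ω).re) (nhdsWithin (0:ℝ) (Set.Ioi 0)) (Set.Icc (-(δ / 2)) (δ / 2)) := by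
    refine (tendstoUniformlyOn_re hGunif).congr ?_
    filter_upwards [self_mem_nhdsWithin] with ν hν ω _
    exact re_laplace_coeff_eq _ _ (fun t => D.currentCorrelation Z.μ t) hcoef hν ω
  -- the spectral measure (Stub 2) from continuity, evenness and positive-definiteness of `C_T`
  have hCcont : Continuous fun t : ℝ => D.currentCorrelation Z.μ t := by
    have h1 : Continuous fun t : ℝ => ⟪Z.currentClass, Z.koopman t Z.currentClass⟫_ℝ :=
      continuous_const.inner (hsc Z.currentClass)
    refine h1.congr fun t => ?_
    exact Z.inner_currentClass_koopman_eq_currentCorrelation' hRev t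
  have hCeven : ∀ t : ℝ, D.currentCorrelation Z.μ (-t) = D.currentCorrelation Z.μ t :=
    fun t => Z.currentCorrelation_neg hRev t
  have hCpsd : ∀ (n : ℕ) (c τ : Fin n → ℝ),
      0 ≤ ∑ i, ∑ j, c i * c j * D.currentCorrelation Z.μ (τ j - τ i) :=
    fun n c τ => Z.sum_mul_currentCorrelation_nonneg hRev Finset.univ c τ
  obtain ⟨σ, hσfin, hσC⟩ :=
    Summit.AtomisticToContinuum.FouriersLaw.Theorems.MourreDissolution.stub_cosineBochner (fun t => D.currentCorrelation Z.μ t) hCcont hCeven hCpsd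
  -- Poisson inversion on the window (Stub 3)
  have hδ2 : 0 < δ / 2 := by linarith
  obtain ⟨σ', hσ'fin, hσ'C, hhnn, hwin⟩ :=
    Summit.AtomisticToContinuum.FouriersLaw.Theorems.MourreDissolution.stub_poissonWindowInversion σ (fun t => D.currentCorrelation Z.μ t) (δ / 2)
      (fun ω : ℝ => (G ω).re) hσfin hδ2 hσC hhcont hunif
  -- positivity of the plateau (Stub 7)
  obtain ⟨c, ν₀, hc, hν₀, hfloor⟩ :=
    hP T hT (lt_of_lt_of_le hTlt (min_le_right _ _)) D Z hDcar hGibbs hSS hRev hsc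
  have h0mem : (0:ℝ) ∈ Set.Icc (-(δ / 2)) (δ / 2) := ⟨by linarith, by linarith⟩
  have hlim0 := hunif.tendsto_at h0mem
  have hh0 : c ≤ (G 0).re := by
    refine ge_of_tendsto hlim0 ?_
    have hev : ∀ᶠ ν in nhdsWithin (0:ℝ) (Set.Ioi 0), ν ∈ Set.Ioo 0 ν₀ := Ioo_mem_nhdsGT hν₀
    filter_upwards [hev] with ν hν
    have := hfloor ν hν.1 hν.2
    simpa using this
  -- assemble the witness
  haveI := hσ'fin
  refine ⟨Z.μ, D, hGibbs, Z.preservesMeasure, fun t => Z.hasAbsConvergentCorrelation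
    (Z.integral_bondCurrent_eq_zero hRev) t, σ', hσ'fin, hσ'C, δ / 2, fun ω => (G ω).re / Real.pi,
    hδ2, ?_, ?_, ?_, hwin⟩
  · exact (hhcont.mono Set.Ioo_subset_Icc_self).div_const _
  · intro ω hω
    exact div_nonneg (hhnn ω hω) Real.pi_pos.le
  · exact div_pos (lt_of_lt_of_le hc hh0) Real.pi_pos

end Summit.AtomisticToContinuum.FouriersLaw.Theorems.MourreDissolution.LineReduction

end
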